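import Mathlib
import HarnessLib
import Literature.Probability.MarkovChains.PeskunOrdering

/-!
# Simple random walk on a graph: `π(x) = deg(x)/2|E|`, reversibility, irreducible ⇔ connected (Levin–Peres–Wilmer §1.4–§1.6)

HONEST FRAMING: exact (Metropolis-corrected) sampling algorithms for lattice gauge theory; figures
of merit are autocorrelation/cost numbers at stated couplings and volumes; no continuum-physics claim.

Conventions of `TotalVariation.lean` (`IsRowStochastic`), `MetropolisHastings.lean` (`IsStationary`,
`DetailedBalance`) and `PeskunOrdering.lean` (`IsIrreducible P`: `∀ x y, ∃ n, 0 < (Pⁿ)(x,y)`); graphs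
are Mathlib's `SimpleGraph V` on a finite vertex type with decidable adjacency (`G.degree`,
`G.edgeFinset`, `G.Reachable`, `G.Preconnected`).  Source: D. A. Levin, Y. Peres (with E. L. Wilmer),
*Markov Chains and Mixing Times*, 2nd ed., AMS 2017 [LevinPeres2017], §1.4 eq. (1.13), §1.5
Example 1.12, §1.6 Example 1.21, Exercise 1.2 (pp. 8–10, 14, 17).  Everything is PROVED (finite sums;
0 named facts).

* `srwKernel G` — **eq. (1.13)**: simple random walk on `G`, `P(x,y) = 1/deg(x)` if `y ∼ x` and `0`
  otherwise [cite: LevinPeres2017, §1.4 eq. (1.13)]; `srwKernel_isRowStochastic` — a transition matrix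
  when no vertex is isolated;
* **EXAMPLE 1.12** `LevinPeres2017_example_1_12` — `Σ_x deg(x)P(x,y) = deg(y)` (eq. (1.16)), and
  `degreeLaw G` — **`π(y) = deg(y)/2|E|` is a stationary distribution** (`degreeLaw_isStationary`,
  `sum_degreeLaw` via the handshake lemma `Σ_y deg(y) = 2|E|`) [cite: LevinPeres2017, §1.5
  Example 1.12]; for a `d`-regular graph the uniform distribution is stationary
  (`LevinPeres2017_example_1_12_regular`) [cite: LevinPeres2017, §1.5 (sentence after Example 1.12:
  "If `G` … is `d`-regular … the uniform distribution `π(y) = 1/|V|` … is stationary")];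
* **EXAMPLE 1.21** `LevinPeres2017_example_1_21` — **`π(x)P(x,y) = 1{x∼y}/2|E| = π(y)P(y,x)`: the
  simple random walk is reversible** [cite: LevinPeres2017, §1.6 Example 1.21];
* **EXERCISE 1.2** `srwKernel_isIrreducible_iff` — **the random walk on `G` is irreducible iff `G` is
  connected** (`G.Preconnected`; `pow_srwKernel_pos_of_walk`: a walk of length `n` from `x` to `y`
  gives `Pⁿ(x,y) > 0`, and `reachable_of_pow_srwKernel_pos` conversely) [cite: LevinPeres2017,
  Exercise 1.2].

Context (cell pub-lqcd, venture LatticeQCDFlow): nearest-neighbour proposal moves on a finite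
configuration graph (single-link updates, sector-hopping moves) are simple random walks; this file
gives their stationary law and the criterion "irreducible iff the move graph is connected" used when
arguing that a move set is ergodic.
-/

namespace Literature.Probability.MarkovChains

open Finset Matrix SimpleGraph

variable {V : Type*} [Fintype V] (G : SimpleGraph V) [DecidableRel G.Adj]

/-- **Eq. (1.13)**: SIMPLE RANDOM WALK on the graph `G` — from `x` move to a uniformly chosen
neighbour: `P(x,y) = 1/deg(x)` if `y ∼ x`, `0` otherwise. [cite: LevinPeres2017, §1.4 eq. (1.13)] -/
noncomputable def srwKernel : Matrix V V ℝ :=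
  Matrix.of fun x y => if G.Adj x y then (1 : ℝ) / G.degree x else 0

/-- The degree-proportional law **`π(y) = deg(y)/2|E|`**. [cite: LevinPeres2017, §1.5 Example 1.12
("the probability measure `π(y) = deg(y)/2|E|` … is always a stationary distribution for the walk")] -/
noncomputable def degreeLaw : V → ℝ :=
  fun y => (G.degree y : ℝ) / (2 * (#G.edgeFinset : ℝ))

variable {G}

/-- Entry formula for (1.13). [cite: LevinPeres2017, §1.4 eq. (1.13)] -/
theorem srwKernel_apply (x y : V) :
    srwKernel G x y = if G.Adj x y then (1 : ℝ) / G.degree x else 0 := rfl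

/-- `P(x,y) ≥ 0`. [cite: LevinPeres2017, §1.4 eq. (1.13) with §1.1 (`P` is stochastic)] -/
theorem srwKernel_nonneg (x y : V) : 0 ≤ srwKernel G x y := by
  rw [srwKernel_apply]
  split_ifs
  · positivity
  · exact le_rfl

/-- `P(x,y) > 0` exactly for neighbours: `x ∼ y ⇒ P(x,y) = 1/deg(x) > 0`. [cite: LevinPeres2017, §1.4
eq. (1.13)] -/
theorem srwKernel_pos_of_adj {x y : V} (h : G.Adj x y) : 0 < srwKernel G x y := by
  rw [srwKernel_apply, if_pos h]
  have hdeg : 0 < G.degree x := (G.degree_pos_iff_exists_adj x).mpr ⟨y, h⟩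
  positivity

/-- `P(x,y) > 0 ⇒ x ∼ y`. [cite: LevinPeres2017, §1.4 eq. (1.13)] -/
theorem adj_of_srwKernel_pos {x y : V} (h : 0 < srwKernel G x y) : G.Adj x y := by
  rw [srwKernel_apply] at h
  by_contra hxy
  rw [if_neg hxy] at h
  exact lt_irrefl _ h

/-- Row sums: `Σ_y P(x,y) = 1` at every non-isolated vertex (`Σ_{y∼x} 1/deg(x) = deg(x)/deg(x)`).
[cite: LevinPeres2017, §1.4 eq. (1.13) ("picks one uniformly at random")] -/
theorem sum_srwKernel {x : V} (hx : 0 < G.degree x) : ∑ y, srwKernel G x y = 1 := by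
  simp_rw [srwKernel_apply]
  rw [← sum_filter, ← neighborFinset_eq_filter, sum_const, card_neighborFinset_eq_degree,
    nsmul_eq_mul]
  have : (G.degree x : ℝ) ≠ 0 := Nat.cast_ne_zero.mpr hx.ne'
  field_simp

/-- **The simple random walk is a transition matrix** when `G` has no isolated vertex.
[cite: LevinPeres2017, §1.4 eq. (1.13)] -/
theorem srwKernel_isRowStochastic (hdeg : ∀ x, 0 < G.degree x) : IsRowStochastic (srwKernel G) :=
  ⟨srwKernel_nonneg, fun x => sum_srwKernel (hdeg x)⟩

/-! ## Example 1.12: `π(y) = deg(y)/2|E|` is stationary -/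

/-- **EXAMPLE 1.12, eq. (1.16)**: `Σ_x deg(x)P(x,y) = Σ_{x∼y} deg(x)/deg(x) = deg(y)`.
[cite: LevinPeres2017, §1.5 Example 1.12 eq. (1.16)] -/
theorem LevinPeres2017_example_1_12 (y : V) : ∑ x, (G.degree x : ℝ) * srwKernel G x y = G.degree y := by
  have hterm : ∀ x, (G.degree x : ℝ) * srwKernel G x y = if G.Adj y x then 1 else 0 := by
    intro x
    rw [srwKernel_apply]
    by_cases h : G.Adj x y
    · rw [if_pos h, if_pos h.symm]
      have hdeg : (G.degree x : ℝ) ≠ 0 :=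
        Nat.cast_ne_zero.mpr ((G.degree_pos_iff_exists_adj x).mpr ⟨y, h⟩).ne'
      field_simp
    · rw [if_neg h, if_neg fun h' => h h'.symm, mul_zero]
  simp_rw [hterm]
  rw [← sum_filter, ← neighborFinset_eq_filter, sum_const, card_neighborFinset_eq_degree,
    nsmul_eq_mul, mul_one]

/-- `degreeLaw` unfolded. [cite: LevinPeres2017, §1.5 Example 1.12] -/
theorem degreeLaw_apply (y : V) : degreeLaw G y = (G.degree y : ℝ) / (2 * (#G.edgeFinset : ℝ)) := rfl

/-- `π ≥ 0`. [cite: LevinPeres2017, §1.5 Example 1.12] -/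
theorem degreeLaw_nonneg (y : V) : 0 ≤ degreeLaw G y := by
  rw [degreeLaw_apply]
  positivity

/-- **`Σ_y π(y) = 1`** when `G` has at least one edge — the handshake lemma `Σ_y deg(y) = 2|E|` ("a
fact the reader should check"). [cite: LevinPeres2017, §1.5 Example 1.12 ("we simply normalize by
`Σ_{y∈V} deg(y) = 2|E|`")] -/
theorem sum_degreeLaw (hE : 0 < #G.edgeFinset) : ∑ y, degreeLaw G y = 1 := by
  simp_rw [degreeLaw_apply]
  rw [← sum_div, ← Nat.cast_sum, G.sum_degrees_eq_twice_card_edges]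
  push_cast
  have : (#G.edgeFinset : ℝ) ≠ 0 := Nat.cast_ne_zero.mpr hE.ne'
  field_simp

/-- **EXAMPLE 1.12: `π(y) = deg(y)/2|E|` is a stationary distribution** for the simple random walk.
[cite: LevinPeres2017, §1.5 Example 1.12] -/
theorem degreeLaw_isStationary : IsStationary (degreeLaw G) (srwKernel G) := by
  intro y
  simp_rw [degreeLaw_apply, div_mul_eq_mul_div, ← sum_div]
  rw [LevinPeres2017_example_1_12 y]

/-- For a `d`-regular graph (`d ≥ 1`) the **uniform distribution** is stationary for the simple random
walk. [cite: LevinPeres2017, §1.5 (after Example 1.12: "If `G` has the property that every vertex has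
the same degree `d` … the uniform distribution `π(y) = 1/|V|` … is stationary")] -/
theorem LevinPeres2017_example_1_12_regular {d : ℕ} (hreg : G.IsRegularOfDegree d) (hd : 0 < d) :
    IsStationary (fun _ : V => (1 : ℝ) / Fintype.card V) (srwKernel G) := by
  intro y
  have hdeg : ∀ x, G.degree x = d := hreg
  have h := LevinPeres2017_example_1_12 (G := G) y
  simp_rw [hdeg] at h
  -- `Σ_x d P(x,y) = d`, so `Σ_x P(x,y) = 1`
  have hd' : (d : ℝ) ≠ 0 := Nat.cast_ne_zero.mpr hd.ne'
  have hcol : ∑ x, srwKernel G x y = 1 := by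
    rw [← mul_sum] at h
    field_simp at h
    linarith [h]
  rw [← mul_sum, hcol, mul_one]

/-! ## Example 1.21: reversibility -/

/-- **EXAMPLE 1.21**: `π(x)P(x,y) = 1{x∼y}/2|E| = π(y)P(y,x)` — the simple random walk is reversible
with respect to `π(x) = deg(x)/2|E|`. [cite: LevinPeres2017, §1.6 Example 1.21] -/
theorem LevinPeres2017_example_1_21 : DetailedBalance (degreeLaw G) (srwKernel G) := by
  have hval : ∀ x y, degreeLaw G x * srwKernel G x y =
      if G.Adj x y then 1 / (2 * (#G.edgeFinset : ℝ)) else 0 := by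
    intro x y
    rw [degreeLaw_apply, srwKernel_apply]
    by_cases h : G.Adj x y
    · rw [if_pos h, if_pos h]
      have hdeg : (G.degree x : ℝ) ≠ 0 :=
        Nat.cast_ne_zero.mpr ((G.degree_pos_iff_exists_adj x).mpr ⟨y, h⟩).ne'
      field_simp
    · rw [if_neg h, if_neg h, mul_zero]
  intro x y
  rw [hval x y, hval y x]
  by_cases h : G.Adj x y
  · rw [if_pos h, if_pos h.symm]
  · rw [if_neg h, if_neg fun h' => h h'.symm]

/-! ## Exercise 1.2: irreducible iff connected -/

variable [DecidableEq V]

/-- A walk of length `n` from `x` to `y` in `G` gives `Pⁿ(x,y) > 0` (each step `P(x_i,x_{i+1}) =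
1/deg(x_i) > 0`). [cite: LevinPeres2017, Exercise 1.2 (a connecting sequence `x = x_0 ∼ x_1 ∼ ⋯ ∼
x_k = y`)] -/
theorem pow_srwKernel_pos_of_walk {x y : V} (p : G.Walk x y) : 0 < (srwKernel G ^ p.length) x y := by
  induction p with
  | nil =>
    rw [Walk.length_nil, pow_zero, one_apply_eq]
    exact one_pos
  | @cons u v w h q ih =>
    rw [Walk.length_cons, pow_succ', mul_apply]
    calc (0 : ℝ) < srwKernel G u v * (srwKernel G ^ q.length) v w :=
          mul_pos (srwKernel_pos_of_adj h) ih
      _ ≤ ∑ z, srwKernel G u z * (srwKernel G ^ q.length) z w :=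
          single_le_sum (f := fun z => srwKernel G u z * (srwKernel G ^ q.length) z w)
            (fun z _ => mul_nonneg (srwKernel_nonneg u z)
              (Matrix.pow_apply_nonneg (fun a b => srwKernel_nonneg a b) _ z w)) (mem_univ v)

/-- Conversely `Pⁿ(x,y) > 0` gives a walk from `x` to `y`: `G.Reachable x y`.
[cite: LevinPeres2017, Exercise 1.2] -/
theorem reachable_of_pow_srwKernel_pos : ∀ (n : ℕ) {x y : V},
    0 < (srwKernel G ^ n) x y → G.Reachable x y := by
  intro n
  induction n with
  | zero =>
    intro x y h
    rcases eq_or_ne x y with rfl | hne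
    · exact Reachable.refl x
    · rw [pow_zero, one_apply_ne hne] at h
      exact absurd h (lt_irrefl 0)
  | succ n ih =>
    intro x y h
    rw [pow_succ', mul_apply] at h
    obtain ⟨z, -, hz⟩ := exists_lt_of_sum_lt (by simpa using h :
      ∑ z, (0 : ℝ) < ∑ z, srwKernel G x z * (srwKernel G ^ n) z y)
    have hxz : 0 < srwKernel G x z := by
      rcases (srwKernel_nonneg (G := G) x z).lt_or_eq with h1 | h1
      · exact h1
      · rw [← h1, zero_mul] at hz
        exact absurd hz (lt_irrefl 0)
    have hzy : 0 < (srwKernel G ^ n) z y := by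
      rcases (Matrix.pow_apply_nonneg (fun a b => srwKernel_nonneg (G := G) a b) n z y).lt_or_eq
        with h1 | h1
      · exact h1
      · rw [← h1, mul_zero] at hz
        exact absurd hz (lt_irrefl 0)
    exact (adj_of_srwKernel_pos hxz).reachable.trans (ih hzy)

/-- **EXERCISE 1.2: the random walk on `G` is irreducible if and only if `G` is connected** (every two
vertices joined by a walk, `G.Preconnected`). [cite: LevinPeres2017, Exercise 1.2 ("Show that random
walk on `G` is irreducible if and only if `G` is connected")] -/
theorem srwKernel_isIrreducible_iff : IsIrreducible (srwKernel G) ↔ G.Preconnected := by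
  constructor
  · intro h x y
    obtain ⟨n, hn⟩ := h x y
    exact reachable_of_pow_srwKernel_pos n hn
  · intro h x y
    obtain ⟨p⟩ := h x y
    exact ⟨p.length, pow_srwKernel_pos_of_walk p⟩

end Literature.Probability.MarkovChains
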